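import Literature.NumberTheory.EllipticCurves.ModularPolynomialDegY
import Literature.NumberTheory.EllipticCurves.TateSeriesGrowth
import HarnessLib

/-!
# The height of the modular equation of prime level: `log |coeff Φ_p| ≪ p^{3/2}` (Mahler 1974)

Everything in this file is **proved**; there are no new definitions.  For a prime `p` let
`Φ_p(X, Y) = Σ_m P_m(Y) X^m ∈ ℤ[X, Y]` be the modular equation of level `p`
(`modularPolynomial p`, `ModularPolynomial.lean`; `P_m = modularPolynomialCoeff p m`).  We prove
K. Mahler's elementary estimate for its coefficients in the form

* `exists_norm_coeff_modularPolynomial_le` :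
  `∃ c, ∀ p prime, ∀ m i, ‖coeff of Yⁱ in P_m‖ ≤ exp (c · p · √p)`

(Mahler 1974: `log L(Φ_n) ≪ n^{3/2}`; P. Cohen 1984 has the true order `6 ψ(n) log n`, which we
do not need).  This is exactly the hypothesis `hheight` of
`Literature.NumberTheory.Transcendental.mahlerManinPadic_of_modularPolynomial_height`
(`MahlerManinFromModularPolynomial.lean`), the last classical input of the tree's formalisation of
the Barré-Sirieix–Diaz–Gramain–Philibert proof of the Mahler–Manin conjecture
(Nesterenko–Philippon, LNM 1752, Ch. 2, Lemma 2.5 and the remark after it: "the older result of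
K. Mahler (`log L(Φ_n) ≪ n^{3/2}`) would be sufficient for our purpose").

## The argument (majorants of `q`-expansions)

Write `c(n) ≥ 0` for the coefficients of `q·j = formalXJ` and `c_k(n)` for those of `(q·j)^k`.
1. *Majorants.* If complex power series `φᵢ` are dominated coefficientwise in norm by real series
   `ψᵢ`, so are products (`norm_coeff_prod_le_of_le`), and the same one level up for polynomials
   over power series (`norm_coeff_coeff_prod_le_of_le`).
2. *The formal product.* In `ModularPolynomialKronecker.lean` the `q_p`-expansion
   (`q_p = e^{2πiτ/p}`) of `q_p^{p(p+1)} Φ_p(Y, j(τ))` is the formal product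
   `𝒫 = ∏ᵢ (X^{wᵢ} Y − Aᵢ)` over the `p + 1` conjugates, with `A_k = Σ c(n) ζ^{k(n-1)} Xⁿ` and
   `A_∞ = Σ c(n) X^{p²n}`.  Every factor is dominated by `Θ·Y + Θ` with
   `Θ = Σ Xⁿ + (q·j)_ℝ + (q·j)_ℝ(X^{p²})`, whose coefficients are `≤ 3e^{27} e^{56√n}` by the tree's
   `c(n) ≤ e^{56√n + 27}` (`coeff_formalXJ_le_exp`); hence
   `‖coeff_n 𝒫_m‖ ≤ 2^{p+1} coeff_n(Θ^{p+1}) ≤ 2^{p+1} (3e^{27}(n+1))^{p+1} e^{56√((p+1)n)}`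
   (`coeff_pow_le_of_coeff_le_exp`, by induction with `√(ra) + √b ≤ √((r+1)(a+b))`).  Only
   `n ≤ p(p+1)` matters, so this is `exp(O(p^{3/2}))` — the source of Mahler's exponent.
3. *The triangular recursion.* The identity `X^{p(N−p−1)} 𝒫_m = Σ_{i ≤ N} π_{m,i} Wⁱ X^{p(N−i)}`
   (`X_pow_mul_coeff_formalPhi_map`, `W = (q·j)(X^p)`, `π_{m,i}` the coefficients of `P_m`,
   `π_{m,i} = 0` for `i > p + 1` by `natDegree_modularPolynomialCoeff_le_succ`) gives, comparing
   coefficients of `X^{p(N−i₀)}`,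
   `π_{m,i₀} = coeff_{p(p+1−i₀)} 𝒫_m − Σ_{i₀ < i ≤ p+1} π_{m,i} c_i(i − i₀)`.
   With the geometric bound `c_k(r) ≤ (e^{83} k)^r` (`coeff_formalXJ_pow_le_geom`) the recursion
   `y_{i₀} ≤ B + Σ_{i > i₀} y_i θ^{i−i₀}` (`θ = e^{83}(p+1)`) yields `y_{i₀} ≤ B (1 + 2θ)^{p+1−i₀}`
   (`le_geom_of_rec`), i.e. `‖π_{m,i}‖ ≤ exp(O(p^{3/2})) · exp(O(p log p))`.
4. Bookkeeping of the constants: `‖π_{m,i}‖ ≤ exp(600 p √p)`.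

## References

* K. Mahler, *On the coefficients of transformation polynomials for the modular function*,
  Bull. Austral. Math. Soc. 10 (1974) 197–218 (the estimate `log L(Φ_n) ≪ n^{3/2}`).
* [NesterenkoPhilippon2001] Yu. V. Nesterenko, P. Philippon (eds.), *Introduction to Algebraic
  Independence Theory*, LNM 1752, Springer 2001, Ch. 2 (G. Diaz), Lemma 2.5 and the remark
  following it (book p. 17).
* P. Cohen, *On the coefficients of the transformation polynomials for the elliptic modular
  function*, Math. Proc. Cambridge Philos. Soc. 95 (1984) 389–402.
* D. A. Cox, *Primes of the form x² + ny²*, 2nd ed., Wiley 2013, §11.C (the `q`-expansion set-up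
  of `ModularPolynomialKronecker.lean`). [Cox2013]
-/

noncomputable section

open PowerSeries Finset

namespace Literature.NumberTheory.EllipticCurves

/-! ### Majorants of complex power series by real power series -/

/-- Products of coefficientwise-dominated series are dominated by the product of the majorants.
[folklore] -/
theorem norm_coeff_mul_le_of_le {φ₁ φ₂ : PowerSeries ℂ} {ψ₁ ψ₂ : PowerSeries ℝ}
    (h₁ : ∀ n, ‖coeff n φ₁‖ ≤ coeff n ψ₁) (h₂ : ∀ n, ‖coeff n φ₂‖ ≤ coeff n ψ₂) (n : ℕ) :
    ‖coeff n (φ₁ * φ₂)‖ ≤ coeff n (ψ₁ * ψ₂) := by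
  rw [PowerSeries.coeff_mul, PowerSeries.coeff_mul]
  refine (norm_sum_le _ _).trans (sum_le_sum fun x _ ↦ ?_)
  rw [norm_mul]
  exact mul_le_mul (h₁ _) (h₂ _) (norm_nonneg _) ((norm_nonneg _).trans (h₁ _))

/-- Finite products of coefficientwise-dominated series are dominated by the product of the
majorants. [folklore] -/
theorem norm_coeff_prod_le_of_le {ι : Type*} (s : Finset ι) {φ : ι → PowerSeries ℂ}
    {ψ : ι → PowerSeries ℝ} (h : ∀ i ∈ s, ∀ n, ‖coeff n (φ i)‖ ≤ coeff n (ψ i)) (n : ℕ) :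
    ‖coeff n (∏ i ∈ s, φ i)‖ ≤ coeff n (∏ i ∈ s, ψ i) := by
  classical
  induction s using Finset.induction_on generalizing n with
  | empty =>
    simp only [prod_empty, PowerSeries.coeff_one]
    split_ifs <;> simp
  | insert a s ha ih =>
    rw [prod_insert ha, prod_insert ha]
    exact norm_coeff_mul_le_of_le (h a (mem_insert_self a s))
      (fun n ↦ ih (fun i hi ↦ h i (mem_insert_of_mem hi)) n) n

/-- The same one level up: products of polynomials over power series whose coefficients are
dominated. [folklore] -/
theorem norm_coeff_coeff_mul_le_of_le {P₁ P₂ : Polynomial (PowerSeries ℂ)}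
    {Q₁ Q₂ : Polynomial (PowerSeries ℝ)}
    (h₁ : ∀ m n, ‖coeff n (P₁.coeff m)‖ ≤ coeff n (Q₁.coeff m))
    (h₂ : ∀ m n, ‖coeff n (P₂.coeff m)‖ ≤ coeff n (Q₂.coeff m)) (m n : ℕ) :
    ‖coeff n ((P₁ * P₂).coeff m)‖ ≤ coeff n ((Q₁ * Q₂).coeff m) := by
  rw [Polynomial.coeff_mul, Polynomial.coeff_mul, map_sum, map_sum]
  refine (norm_sum_le _ _).trans (sum_le_sum fun x _ ↦ ?_)
  exact norm_coeff_mul_le_of_le (h₁ x.1) (h₂ x.2) n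

/-- Finite products of polynomials over power series with dominated coefficients. [folklore] -/
theorem norm_coeff_coeff_prod_le_of_le {ι : Type*} (s : Finset ι)
    {P : ι → Polynomial (PowerSeries ℂ)} {Q : ι → Polynomial (PowerSeries ℝ)}
    (h : ∀ i ∈ s, ∀ m n, ‖coeff n ((P i).coeff m)‖ ≤ coeff n ((Q i).coeff m)) (m n : ℕ) :
    ‖coeff n ((∏ i ∈ s, P i).coeff m)‖ ≤ coeff n ((∏ i ∈ s, Q i).coeff m) := by
  classical
  induction s using Finset.induction_on generalizing m n with
  | empty =>
    simp only [prod_empty, Polynomial.coeff_one]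
    split_ifs
    · simp only [PowerSeries.coeff_one]
      split_ifs <;> simp
    · simp
  | insert a s ha ih =>
    rw [prod_insert ha, prod_insert ha]
    exact norm_coeff_coeff_mul_le_of_le (h a (mem_insert_self a s))
      (fun m n ↦ ih (fun i hi ↦ h i (mem_insert_of_mem hi)) m n) m n

/-- A linear factor `X^w · Y − A` is dominated by `Θ · Y + Θ` as soon as `A` is dominated by `Θ`
and all coefficients of `Θ` are `≥ 1`. [folklore] -/
theorem norm_coeff_coeff_linearFactor_le {w : ℕ} {A : PowerSeries ℂ} {Θ : PowerSeries ℝ}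
    (h1 : ∀ n, 1 ≤ coeff n Θ) (hA : ∀ n, ‖coeff n A‖ ≤ coeff n Θ) (m n : ℕ) :
    ‖coeff n ((Polynomial.C (PowerSeries.X ^ w) * Polynomial.X - Polynomial.C A).coeff m)‖ ≤
      coeff n ((Polynomial.C Θ * Polynomial.X + Polynomial.C Θ).coeff m) := by
  rw [Polynomial.coeff_sub, Polynomial.coeff_add, Polynomial.coeff_C_mul_X, Polynomial.coeff_C,
    Polynomial.coeff_C_mul_X, Polynomial.coeff_C]
  have h0 : ∀ n, 0 ≤ coeff n Θ := fun n ↦ zero_le_one.trans (h1 n)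
  rcases eq_or_ne m 1 with rfl | hm1
  · simp only [if_true, show (1 : ℕ) ≠ 0 from one_ne_zero, if_false, sub_zero, add_zero,
      coeff_X_pow]
    split_ifs
    · simpa using h1 n
    · simpa using h0 n
  · rcases eq_or_ne m 0 with rfl | hm0
    · simp only [show (0 : ℕ) ≠ 1 from zero_ne_one, if_false, if_true, zero_sub, zero_add,
        map_neg, norm_neg]
      exact hA n
    · simp only [hm1, hm0, if_false, sub_zero, add_zero, map_zero, norm_zero, le_refl]

/-! ### Growth of the coefficients of powers -/

/-- `√(r a) + √b ≤ √((r + 1)(a + b))` for `r, a, b ≥ 0` (Cauchy–Schwarz in `ℝ²`). [folklore] -/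
theorem sqrt_mul_add_sqrt_le {r a b : ℝ} (hr : 0 ≤ r) (ha : 0 ≤ a) (hb : 0 ≤ b) :
    Real.sqrt (r * a) + Real.sqrt b ≤ Real.sqrt ((r + 1) * (a + b)) := by
  rw [Real.le_sqrt (by positivity) (by positivity)]
  have hu := Real.sq_sqrt (show 0 ≤ r * b by positivity)
  have hv := Real.sq_sqrt ha
  have hra := Real.sq_sqrt (show 0 ≤ r * a by positivity)
  have hbb := Real.sq_sqrt hb
  -- `√(ra) √b = √(rb) √a`
  have hx : Real.sqrt (r * a) * Real.sqrt b = Real.sqrt (r * b) * Real.sqrt a := by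
    rw [← Real.sqrt_mul (by positivity), ← Real.sqrt_mul (by positivity)]
    ring_nf
  nlinarith [sq_nonneg (Real.sqrt (r * b) - Real.sqrt a), hx,
    Real.sqrt_nonneg (r * a), Real.sqrt_nonneg b]

/-- Nonnegativity of the coefficients of powers of a series with nonnegative coefficients. [folklore] -/
theorem coeff_pow_nonneg_real {Θ : PowerSeries ℝ} (h0 : ∀ n, 0 ≤ coeff n Θ) (r n : ℕ) :
    0 ≤ coeff n (Θ ^ r) := by
  induction r generalizing n with
  | zero => simp only [pow_zero, PowerSeries.coeff_one]; split_ifs <;> norm_num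
  | succ r ih =>
    rw [pow_succ, PowerSeries.coeff_mul]
    exact sum_nonneg fun x _ ↦ mul_nonneg (ih _) (h0 _)

/-- **Growth of powers of a series with `O(e^{56√n})` coefficients**: if
`0 ≤ coeff_n Θ ≤ K e^{56√n}` for all `n`, then `coeff_n (Θ^r) ≤ (K(n+1))^r e^{56√(rn)}`.
[folklore] -/
theorem coeff_pow_le_of_coeff_le_exp {Θ : PowerSeries ℝ} {K : ℝ} (hK : 0 ≤ K)
    (h0 : ∀ n, 0 ≤ coeff n Θ) (hΘ : ∀ n, coeff n Θ ≤ K * Real.exp (56 * Real.sqrt n)) (r n : ℕ) :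
    coeff n (Θ ^ r) ≤ (K * (n + 1)) ^ r * Real.exp (56 * Real.sqrt (r * n)) := by
  induction r generalizing n with
  | zero =>
    simp only [pow_zero, PowerSeries.coeff_one, CharP.cast_eq_zero, zero_mul, Real.sqrt_zero,
      mul_zero, Real.exp_zero, mul_one]
    split_ifs <;> norm_num
  | succ r ih =>
    rw [pow_succ, PowerSeries.coeff_mul]
    have hcard : ((antidiagonal n).card : ℝ) = n + 1 := by rw [Nat.card_antidiagonal]; push_cast; ring
    have key : ∀ x ∈ antidiagonal n, coeff x.1 (Θ ^ r) * coeff x.2 Θ ≤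
        (K * (n + 1)) ^ r * K * Real.exp (56 * Real.sqrt ((r + 1 : ℕ) * n)) := by
      intro x hx
      have hxn : x.1 + x.2 = n := mem_antidiagonal.mp hx
      have hx1 : (x.1 : ℝ) ≤ n := by exact_mod_cast hxn ▸ Nat.le_add_right x.1 x.2
      have e1 := ih x.1
      have e2 := hΘ x.2
      have hpow : (K * (x.1 + 1)) ^ r ≤ (K * (n + 1)) ^ r :=
        pow_le_pow_left₀ (by positivity) (by nlinarith) r
      have hexp : Real.exp (56 * Real.sqrt (r * x.1)) * Real.exp (56 * Real.sqrt x.2) ≤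
          Real.exp (56 * Real.sqrt ((r + 1 : ℕ) * n)) := by
        rw [← Real.exp_add, Real.exp_le_exp]
        have := sqrt_mul_add_sqrt_le (r := r) (a := x.1) (b := x.2) (by positivity)
          (by positivity) (by positivity)
        have hn : ((x.1 : ℝ) + x.2) = n := by exact_mod_cast hxn
        rw [hn] at this
        push_cast
        linarith
      calc coeff x.1 (Θ ^ r) * coeff x.2 Θ
          ≤ ((K * (x.1 + 1)) ^ r * Real.exp (56 * Real.sqrt (r * x.1))) *
              (K * Real.exp (56 * Real.sqrt x.2)) :=
            mul_le_mul e1 e2 (h0 _) ((coeff_pow_nonneg_real h0 r x.1).trans e1)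
        _ = ((K * (x.1 + 1)) ^ r * K) *
              (Real.exp (56 * Real.sqrt (r * x.1)) * Real.exp (56 * Real.sqrt x.2)) := by ring
        _ ≤ ((K * (n + 1)) ^ r * K) * Real.exp (56 * Real.sqrt ((r + 1 : ℕ) * n)) :=
            mul_le_mul (mul_le_mul_of_nonneg_right hpow hK) hexp (by positivity) (by positivity)
    calc ∑ x ∈ antidiagonal n, coeff x.1 (Θ ^ r) * coeff x.2 Θ
        ≤ ∑ x ∈ antidiagonal n, (K * (n + 1)) ^ r * K * Real.exp (56 * Real.sqrt ((r + 1 : ℕ) * n)) :=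
          sum_le_sum key
      _ = (n + 1) * ((K * (n + 1)) ^ r * K * Real.exp (56 * Real.sqrt ((r + 1 : ℕ) * n))) := by
          rw [sum_const, nsmul_eq_mul, hcard]
      _ = (K * (n + 1)) ^ (r + 1) * Real.exp (56 * Real.sqrt ((r + 1 : ℕ) * n)) := by ring

/-! ### The geometric bound `c_k(r) ≤ (e^{83} k)^r` for the coefficients of `(q·j)^k` -/

/-- `Σ_{i ≤ r} k^i ≤ (k + 1)^r`. [folklore] -/
theorem sum_range_pow_le_succ_pow_real (k : ℝ) (hk : 0 ≤ k) (r : ℕ) :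
    ∑ i ∈ range (r + 1), k ^ i ≤ (k + 1) ^ r := by
  induction r with
  | zero => simp
  | succ r ih =>
    rw [sum_range_succ]
    have h1 : k ^ (r + 1) ≤ k * (k + 1) ^ r := by
      rw [pow_succ']
      exact mul_le_mul_of_nonneg_left (pow_le_pow_left₀ hk (by linarith) r) hk
    calc ∑ i ∈ range (r + 1), k ^ i + k ^ (r + 1) ≤ (k + 1) ^ r + k * (k + 1) ^ r := add_le_add ih h1
      _ = (k + 1) ^ (r + 1) := by ring

/-- `c(n) ≤ e^{83 n}` for the coefficients of `q·j` (from `c(n) ≤ e^{56√n + 27}`). [folklore] -/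
theorem coeff_formalXJ_le_exp_mul (n : ℕ) :
    ((coeff n formalXJ : ℤ) : ℝ) ≤ Real.exp 83 ^ n := by
  rcases Nat.eq_zero_or_pos n with rfl | hn
  · rw [coeff_zero_eq_constantCoeff_apply, constantCoeff_formalXJ]; simp
  refine (coeff_formalXJ_le_exp n).trans ?_
  rw [← Real.exp_nat_mul, Real.exp_le_exp]
  have hn1 : (1 : ℝ) ≤ n := by exact_mod_cast hn
  have hs : Real.sqrt n ≤ n := by
    rw [Real.sqrt_le_iff]; exact ⟨by positivity, by nlinarith⟩
  nlinarith

/-- **Geometric bound for the coefficients of `(q·j)^k`**: `c_k(r) ≤ (e^{83} k)^r`.  For fixed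
order `r` this is polynomial in `k`, which is what the triangular recursion needs (the bound
`e^{56√(kr) + 27k}` of `TateSeriesGrowth.lean` is far too weak for `r ≪ k`). [folklore] -/
theorem coeff_formalXJ_pow_le_geom (k r : ℕ) :
    ((coeff r (formalXJ ^ k) : ℤ) : ℝ) ≤ (Real.exp 83 * k) ^ r := by
  induction k generalizing r with
  | zero =>
    simp only [pow_zero, PowerSeries.coeff_one, CharP.cast_eq_zero, mul_zero]
    split_ifs with h
    · subst h; simp
    · rw [zero_pow h]; simp
  | succ k ih =>
    rw [pow_succ, PowerSeries.coeff_mul, Int.cast_sum]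
    have key : ∀ x ∈ antidiagonal r, (((coeff x.1 (formalXJ ^ k) * coeff x.2 formalXJ : ℤ)) : ℝ) ≤
        Real.exp 83 ^ r * (k : ℝ) ^ x.1 := by
      intro x hx
      have hxr : x.1 + x.2 = r := mem_antidiagonal.mp hx
      rw [Int.cast_mul]
      calc ((coeff x.1 (formalXJ ^ k) : ℤ) : ℝ) * ((coeff x.2 formalXJ : ℤ) : ℝ)
          ≤ (Real.exp 83 * k) ^ x.1 * Real.exp 83 ^ x.2 :=
            mul_le_mul (ih x.1) (coeff_formalXJ_le_exp_mul x.2)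
              (by exact_mod_cast coeff_formalXJ_nonneg x.2)
              ((by exact_mod_cast coeff_formalXJ_pow_nonneg k x.1 : (0 : ℝ) ≤ _).trans (ih x.1))
        _ = Real.exp 83 ^ r * (k : ℝ) ^ x.1 := by rw [← hxr, mul_pow, pow_add]; ring
    refine (sum_le_sum key).trans ?_
    rw [← mul_sum, Nat.sum_antidiagonal_eq_sum_range_succ (fun i _ ↦ (k : ℝ) ^ i) r, mul_pow]
    push_cast
    exact mul_le_mul_of_nonneg_left (sum_range_pow_le_succ_pow_real k (Nat.cast_nonneg k) r)
      (by positivity)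


/-! ### The majorant `Θ` of the conjugate series and the bound for the formal product -/

section level

variable (p : ℕ) [Fact p.Prime]

/-- **A common majorant of the conjugate `q_p`-expansions.**  There is a real series `Θ` (namely
`Σₙ (1 + c(n) + [p² ∣ n] c(n/p²)) Xⁿ`) with `1 ≤ coeff_n Θ ≤ 3e^{27} e^{56√n}` dominating all the
`𝒜ᵢ`: `‖coeff_n 𝒜ᵢ‖ ≤ coeff_n Θ` (`‖ζ‖ = 1` and `c(n) ≤ e^{56√n+27}`). [folklore] -/
theorem exists_majorant_conjSeries : ∃ Θ : PowerSeries ℝ, (∀ n, 1 ≤ coeff n Θ) ∧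
    (∀ n, coeff n Θ ≤ 3 * Real.exp 27 * Real.exp (56 * Real.sqrt n)) ∧
    ∀ (i : Option (ZMod p)) n, ‖coeff n ((conjSeries p i).map (cycEmb p))‖ ≤ coeff n Θ := by
  have hc0 : ∀ n, (0 : ℝ) ≤ (coeff n formalXJ : ℤ) := fun n ↦ by exact_mod_cast coeff_formalXJ_nonneg n
  have hce : ∀ n, ((coeff n formalXJ : ℤ) : ℝ) ≤ Real.exp 27 * Real.exp (56 * Real.sqrt n) := fun n ↦ by
    rw [← Real.exp_add, add_comm]; exact coeff_formalXJ_le_exp n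
  refine ⟨PowerSeries.mk fun n ↦ 1 + ((coeff n formalXJ : ℤ) : ℝ) +
    (if p * p ∣ n then ((coeff (n / (p * p)) formalXJ : ℤ) : ℝ) else 0), fun n ↦ ?_, fun n ↦ ?_, fun i n ↦ ?_⟩
  · rw [coeff_mk]
    have h1 := hc0 n
    have h2 : (0 : ℝ) ≤ if p * p ∣ n then ((coeff (n / (p * p)) formalXJ : ℤ) : ℝ) else 0 := by
      split_ifs
      · exact hc0 _
      · exact le_rfl
    linarith
  · rw [coeff_mk]
    have hE : 1 ≤ Real.exp 27 * Real.exp (56 * Real.sqrt n) :=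
      one_le_mul_of_one_le_of_one_le (Real.one_le_exp (by norm_num)) (Real.one_le_exp (by positivity))
    have h3 : (if p * p ∣ n then ((coeff (n / (p * p)) formalXJ : ℤ) : ℝ) else 0) ≤
        Real.exp 27 * Real.exp (56 * Real.sqrt n) := by
      split_ifs
      · refine (hce _).trans (mul_le_mul_of_nonneg_left ?_ (by positivity))
        rw [Real.exp_le_exp]
        have : ((n / (p * p) : ℕ) : ℝ) ≤ n := by exact_mod_cast Nat.div_le_self n (p * p)
        have := Real.sqrt_le_sqrt this
        linarith
      · positivity
    have := hce n
    linarith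
  · rw [coeff_mk]
    cases i with
    | none =>
      have h1 : (conjSeries p none).map (cycEmb p) =
          expand (p * p) (p_sq_ne_zero p) (formalXJ.map (Int.castRingHom ℂ)) := by
        simp only [conjSeries, PowerSeries.map_expand, map_jSeries, jSeries_complex]
      rw [h1, PowerSeries.coeff_expand]
      split_ifs with h
      · rw [PowerSeries.coeff_map, eq_intCast, Complex.norm_intCast, ← Int.cast_abs,
          abs_of_nonneg (coeff_formalXJ_nonneg _)]
        have := hc0 n
        linarith
      · rw [norm_zero]
        have := hc0 n
        linarith
    | some k =>
      have h1 : (conjSeries p (some k)).map (cycEmb p) =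
          PowerSeries.C (zetaP p ^ (k.val * (p - 1))) * rescale (zetaP p ^ k.val)
            (formalXJ.map (Int.castRingHom ℂ)) := by
        simp only [conjSeries, map_twistSeries, jSeries_complex]
      rw [h1, PowerSeries.coeff_C_mul, coeff_rescale, PowerSeries.coeff_map, eq_intCast, norm_mul,
        norm_mul, norm_zetaP_pow, ← pow_mul, norm_zetaP_pow, one_mul, one_mul,
        Complex.norm_intCast, ← Int.cast_abs, abs_of_nonneg (coeff_formalXJ_nonneg _)]
      have h2 : (0 : ℝ) ≤ if p * p ∣ n then ((coeff (n / (p * p)) formalXJ : ℤ) : ℝ) else 0 := by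
        split_ifs
        · exact hc0 _
        · exact le_rfl
      linarith

/-- The majorant product `∏ᵢ (Θ·Y + Θ)` over the `p + 1` conjugates has `m`-th coefficient
`C(p+1, m) Θ^{p+1}`. [folklore] -/
theorem coeff_coeff_prod_linear (Θ : PowerSeries ℝ) (m n : ℕ) :
    coeff n ((∏ _i : Option (ZMod p), (Polynomial.C Θ * Polynomial.X + Polynomial.C Θ)).coeff m) =
      coeff n (Θ ^ (p + 1)) * ((p + 1).choose m : ℝ) := by
  rw [prod_const, card_univ, Fintype.card_option, ZMod.card,
    show Polynomial.C Θ * Polynomial.X + Polynomial.C Θ = Polynomial.C Θ * (Polynomial.X + 1) by ring,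
    mul_pow, ← map_pow, Polynomial.coeff_C_mul, Polynomial.coeff_X_add_one_pow,
    ← map_natCast (PowerSeries.C (R := ℝ)), PowerSeries.coeff_mul_C]

/-- **Bound for the coefficients of the formal product** `𝒫 = ∏ᵢ (X^{wᵢ} Y − 𝒜ᵢ)`:
`‖coeff_n 𝒫_m‖ ≤ 2^{p+1} (3e^{27}(n+1))^{p+1} e^{56√((p+1)n)}`. [folklore] -/
theorem norm_coeff_map_coeff_formalPhi_le (m n : ℕ) :
    ‖coeff n (((formalPhi p).coeff m).map (cycEmb p))‖ ≤
      2 ^ (p + 1) * ((3 * Real.exp 27 * (n + 1)) ^ (p + 1) *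
        Real.exp (56 * Real.sqrt ((p + 1 : ℕ) * n))) := by
  obtain ⟨Θ, h1, hΘ, hdom⟩ := exists_majorant_conjSeries p
  have h0 : ∀ n, 0 ≤ coeff n Θ := fun n ↦ zero_le_one.trans (h1 n)
  have hmap : ((formalPhi p).coeff m).map (cycEmb p) =
      ((formalPhi p).map (PowerSeries.map (cycEmb p))).coeff m := by
    rw [Polynomial.coeff_map]
  have hprod : (formalPhi p).map (PowerSeries.map (cycEmb p)) =
      ∏ i : Option (ZMod p), (Polynomial.C (PowerSeries.X ^ qWeight p i) * Polynomial.X -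
        Polynomial.C ((conjSeries p i).map (cycEmb p))) := by
    simp only [formalPhi, Polynomial.map_prod, Polynomial.map_sub, Polynomial.map_mul,
      Polynomial.map_pow, Polynomial.map_C, Polynomial.map_X, map_pow, PowerSeries.map_X]
  rw [hmap, hprod]
  calc ‖coeff n ((∏ i : Option (ZMod p), (Polynomial.C (PowerSeries.X ^ qWeight p i) * Polynomial.X -
        Polynomial.C ((conjSeries p i).map (cycEmb p)))).coeff m)‖
      ≤ coeff n ((∏ _i : Option (ZMod p), (Polynomial.C Θ * Polynomial.X + Polynomial.C Θ)).coeff m) :=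
        norm_coeff_coeff_prod_le_of_le _
          (fun i _ m n ↦ norm_coeff_coeff_linearFactor_le h1 (hdom i) m n) m n
    _ = coeff n (Θ ^ (p + 1)) * ((p + 1).choose m : ℝ) := coeff_coeff_prod_linear p Θ m n
    _ ≤ ((3 * Real.exp 27 * (n + 1)) ^ (p + 1) * Real.exp (56 * Real.sqrt ((p + 1 : ℕ) * n))) *
          (2 : ℝ) ^ (p + 1) := by
        refine mul_le_mul (coeff_pow_le_of_coeff_le_exp (by positivity) h0 hΘ (p + 1) n) ?_
          (by positivity) (by positivity)
        exact_mod_cast Nat.choose_le_two_pow (p + 1) m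
    _ = _ := by ring

/-! ### The triangular recursion for the coefficients `π_{m,i}` of `P_m` -/

/-- `π_{m,i} = 0` for `i > p + 1` (`deg P_m ≤ p + 1`). [cite: Cox2013, §11.C Thm. 11.18(iii)] -/
theorem coeff_modularPolynomialCoeff_eq_zero {m i : ℕ} (hi : p + 1 < i) :
    (modularPolynomialCoeff p m).coeff i = 0 :=
  Polynomial.coeff_eq_zero_of_natDegree_lt ((natDegree_modularPolynomialCoeff_le_succ p m).trans_lt hi)

/-- **The triangular recursion** read off from `X^{p(N−p−1)} 𝒫_m = Σᵢ π_{m,i} Wⁱ X^{p(N−i)}`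
by comparing the coefficients of `X^{p(N−i₀)}` (`i₀ ≤ p + 1`):
`‖π_{m,i₀}‖ ≤ ‖coeff_{p(p+1−i₀)} 𝒫_m‖ + Σ_{i > i₀} ‖π_{m,i}‖ · c_i(i − i₀)`.
[cite: Cox2013, §11.C proof of Thm. 11.18(i)] -/
theorem norm_coeff_modularPolynomialCoeff_le_add_sum (m : ℕ) {i₀ : ℕ} (hi₀ : i₀ ≤ p + 1) :
    ‖(modularPolynomialCoeff p m).coeff i₀‖ ≤
      ‖coeff (p * (p + 1 - i₀)) (((formalPhi p).coeff m).map (cycEmb p))‖ +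
        ∑ i ∈ range (degBound p + 1), if i₀ < i then
          ‖(modularPolynomialCoeff p m).coeff i‖ * ((coeff (i - i₀) (formalXJ ^ i) : ℤ) : ℝ) else 0 := by
  set N := degBound p with hN
  set P := modularPolynomialCoeff p m with hP
  set G := ((formalPhi p).coeff m).map (cycEmb p) with hG
  have hp0 : 0 < p := (Fact.out : p.Prime).pos
  have hpN : p + 1 ≤ N := succ_le_degBound p
  have hi₀N : i₀ ≤ N := hi₀.trans hpN
  have key := congr_arg (PowerSeries.coeff (p * (N - i₀))) (X_pow_mul_coeff_formalPhi_map p m)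
  -- the left-hand side: the coefficient of `X^{p(p+1-i₀)}` of `𝒫_m`
  have hmul : p * (N - (p + 1)) ≤ p * (N - i₀) := Nat.mul_le_mul_left p (Nat.sub_le_sub_left hi₀ N)
  have hL : PowerSeries.coeff (p * (N - i₀)) (PowerSeries.X ^ (p * (N - (p + 1))) * G) =
      coeff (p * (p + 1 - i₀)) G := by
    have hidx : p * (N - i₀) - p * (N - (p + 1)) = p * (p + 1 - i₀) := by
      zify [hi₀, hpN, hi₀N, Nat.sub_le_sub_left hi₀ N, hmul]
      ring
    rw [PowerSeries.coeff_X_pow_mul', if_pos hmul, hidx]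
  -- the right-hand side: `Σ_{i ≥ i₀} π_{m,i} c_i(i - i₀)`
  have hR : PowerSeries.coeff (p * (N - i₀)) (∑ i ∈ range (N + 1), PowerSeries.C (P.coeff i) *
      (PowerSeries.map (Int.castRingHom ℂ) (expand p (Fact.out : p.Prime).ne_zero formalXJ)) ^ i *
        PowerSeries.X ^ (p * (N - i))) =
      ∑ i ∈ range (N + 1), P.coeff i *
        (if i₀ ≤ i then (((coeff (i - i₀) (formalXJ ^ i) : ℤ)) : ℂ) else 0) := by
    rw [map_sum]
    refine sum_congr rfl fun i hi ↦ ?_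
    have hiN : i ≤ N := Nat.lt_succ_iff.mp (mem_range.mp hi)
    rw [mul_assoc, PowerSeries.coeff_C_mul, PowerSeries.coeff_mul_X_pow']
    congr 1
    by_cases h : i₀ ≤ i
    · have hmul' : p * (N - i) ≤ p * (N - i₀) := Nat.mul_le_mul_left p (Nat.sub_le_sub_left h N)
      have hidx : p * (N - i₀) - p * (N - i) = p * (i - i₀) := by
        zify [h, hiN, hi₀N, hmul']
        ring
      rw [if_pos hmul', if_pos h, hidx, ← map_pow, ← map_pow, PowerSeries.coeff_map,
        PowerSeries.coeff_expand_mul, eq_intCast]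
    · rw [if_neg, if_neg h]
      intro h'
      have := Nat.le_of_mul_le_mul_left h' hp0
      omega
  rw [hL, hR, ← add_sum_erase _ _ (mem_range.mpr (Nat.lt_succ_of_le hi₀N)), if_pos le_rfl,
    Nat.sub_self, PowerSeries.coeff_zero_eq_constantCoeff_apply, map_pow, constantCoeff_formalXJ,
    one_pow, Int.cast_one, mul_one] at key
  have heq : P.coeff i₀ = coeff (p * (p + 1 - i₀)) G - ∑ i ∈ (range (N + 1)).erase i₀,
      P.coeff i * (if i₀ ≤ i then (((coeff (i - i₀) (formalXJ ^ i) : ℤ)) : ℂ) else 0) := by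
    rw [key]; ring
  rw [heq]
  refine (norm_sub_le _ _).trans (add_le_add le_rfl ?_)
  refine (norm_sum_le _ _).trans ?_
  refine le_trans (sum_le_sum fun i hi ↦ ?_) (sum_le_sum_of_subset_of_nonneg (erase_subset i₀ _) ?_)
  · -- termwise (in fact an equality)
    obtain ⟨hne, -⟩ := mem_erase.mp hi
    by_cases h : i₀ < i
    · rw [if_pos h.le, if_pos h, norm_mul, Complex.norm_intCast, ← Int.cast_abs,
        abs_of_nonneg (coeff_formalXJ_pow_nonneg _ _)]
    · have h' : ¬ i₀ ≤ i := fun h' ↦ h (lt_of_le_of_ne h' (Ne.symm hne))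
      rw [if_neg h', if_neg h, mul_zero, norm_zero]
  · intro i _ _
    split_ifs
    · exact mul_nonneg (norm_nonneg _) (by exact_mod_cast coeff_formalXJ_pow_nonneg _ _)
    · exact le_rfl

end level

/-! ### Solving the recursion -/

/-- `1 + Σ_{t < s} R^t θ^{s−t} ≤ R^s` for `R = 1 + 2θ`, `θ ≥ 0`. [folklore] -/
theorem one_add_sum_pow_mul_pow_le {θ : ℝ} (hθ : 0 ≤ θ) (s : ℕ) :
    1 + ∑ t ∈ range s, (1 + 2 * θ) ^ t * θ ^ (s - t) ≤ (1 + 2 * θ) ^ s := by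
  induction s with
  | zero => simp
  | succ s ih =>
    have hR1 : (1 : ℝ) ≤ (1 + 2 * θ) ^ s := one_le_pow₀ (by linarith)
    have hsum : ∑ t ∈ range (s + 1), (1 + 2 * θ) ^ t * θ ^ (s + 1 - t) =
        θ * (∑ t ∈ range s, (1 + 2 * θ) ^ t * θ ^ (s - t)) + θ * (1 + 2 * θ) ^ s := by
      rw [sum_range_succ, Nat.add_sub_cancel_left, pow_one, mul_sum]
      congr 1
      · refine sum_congr rfl fun t ht ↦ ?_
        rw [Nat.sub_add_comm (mem_range.mp ht).le, pow_succ]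
        ring
      · ring
    rw [hsum]
    have h2 : θ * ∑ t ∈ range s, (1 + 2 * θ) ^ t * θ ^ (s - t) ≤ θ * ((1 + 2 * θ) ^ s - 1) :=
      mul_le_mul_of_nonneg_left (by linarith) hθ
    calc 1 + (θ * ∑ t ∈ range s, (1 + 2 * θ) ^ t * θ ^ (s - t) + θ * (1 + 2 * θ) ^ s)
        ≤ 1 + (θ * ((1 + 2 * θ) ^ s - 1) + θ * (1 + 2 * θ) ^ s) := by linarith
      _ ≤ (1 + 2 * θ) ^ s + 2 * θ * (1 + 2 * θ) ^ s := by nlinarith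
      _ = (1 + 2 * θ) ^ (s + 1) := by ring

/-- **Solving the triangular recursion**: if `yᵢ = 0` for `i > D` and
`yᵢ ≤ B + Σ_{j > i} y_j θ^{j−i}` for `i ≤ D` (`B, θ ≥ 0`), then `yᵢ ≤ B (1 + 2θ)^{D−i}`. [folklore] -/
theorem le_geom_of_rec {y : ℕ → ℝ} {B θ : ℝ} {D M : ℕ} (hB : 0 ≤ B) (hθ : 0 ≤ θ)
    (hyD : ∀ j, D < j → y j = 0)
    (hrec : ∀ i ≤ D, y i ≤ B + ∑ j ∈ range M, if i < j then y j * θ ^ (j - i) else 0) :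
    ∀ i ≤ D, y i ≤ B * (1 + 2 * θ) ^ (D - i) := by
  -- induction on `s = D - i`
  suffices h : ∀ s i, i + s = D → y i ≤ B * (1 + 2 * θ) ^ s by
    intro i hi
    exact h (D - i) i (Nat.add_sub_cancel' hi)
  intro s
  induction s using Nat.strong_induction_on with
  | _ s ih =>
    intro i his
    have hiD : i ≤ D := his ▸ Nat.le_add_right i s
    refine (hrec i hiD).trans ?_
    -- bound the sum termwise by `B R^{D-j} θ^{j-i}` on `Ioc i D`, and by zero elsewhere
    have hterm : ∀ j ∈ range M, (if i < j then y j * θ ^ (j - i) else 0) ≤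
        if j ∈ Ioc i D then B * (1 + 2 * θ) ^ (D - j) * θ ^ (j - i) else 0 := by
      intro j _
      by_cases hij : i < j
      · rw [if_pos hij]
        by_cases hjD : j ≤ D
        · rw [if_pos (mem_Ioc.mpr ⟨hij, hjD⟩)]
          have := ih (D - j) (by omega) j (by omega)
          exact mul_le_mul_of_nonneg_right this (pow_nonneg hθ _)
        · rw [hyD j (not_le.mp hjD), zero_mul]
          split_ifs <;> positivity
      · rw [if_neg hij]
        split_ifs <;> positivity
    have hsum : ∑ j ∈ range M, (if i < j then y j * θ ^ (j - i) else 0) ≤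
        ∑ j ∈ Ioc i D, B * (1 + 2 * θ) ^ (D - j) * θ ^ (j - i) := by
      refine (sum_le_sum hterm).trans ?_
      rw [← sum_filter]
      exact sum_le_sum_of_subset_of_nonneg (fun j hj ↦ (mem_filter.mp hj).2)
        fun j _ _ ↦ by positivity
    -- reindex by `t = D - j`
    have hreindex : ∑ j ∈ Ioc i D, B * (1 + 2 * θ) ^ (D - j) * θ ^ (j - i) =
        B * ∑ t ∈ range s, (1 + 2 * θ) ^ t * θ ^ (s - t) := by
      rw [mul_sum]
      refine sum_nbij' (fun j ↦ D - j) (fun t ↦ D - t) ?_ ?_ ?_ ?_ ?_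
      · intro j hj; have := mem_Ioc.mp hj; simp only [mem_range]; omega
      · intro t ht; have := mem_range.mp ht; simp only [mem_Ioc]; omega
      · intro j hj; have := mem_Ioc.mp hj; omega
      · intro t ht; have := mem_range.mp ht; omega
      · intro j hj
        have := mem_Ioc.mp hj
        have hexp : j - i = s - (D - j) := by omega
        rw [hexp, mul_assoc]
    calc B + ∑ j ∈ range M, (if i < j then y j * θ ^ (j - i) else 0)
        ≤ B + B * ∑ t ∈ range s, (1 + 2 * θ) ^ t * θ ^ (s - t) := by rw [← hreindex]; linarith
      _ = B * (1 + ∑ t ∈ range s, (1 + 2 * θ) ^ t * θ ^ (s - t)) := by ring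
      _ ≤ B * (1 + 2 * θ) ^ s := mul_le_mul_of_nonneg_left (one_add_sum_pow_mul_pow_le hθ s) hB

/-! ### The height bound -/

section level

variable (p : ℕ) [Fact p.Prime]

/-- **The height bound at level `p`**: for all `m, i`,
`‖π_{m,i}‖ ≤ B_p · (1 + 2e^{83}(p+1))^{p+1}` with
`B_p = 2^{p+1} (3e^{27}(p(p+1)+1))^{p+1} e^{56√((p+1)·p(p+1))}` the bound for the coefficients of
the formal product in degrees `≤ p(p+1)`. [folklore] -/
theorem norm_coeff_modularPolynomialCoeff_le (m i : ℕ) :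
    ‖(modularPolynomialCoeff p m).coeff i‖ ≤
      (2 ^ (p + 1) * ((3 * Real.exp 27 * (((p * (p + 1) : ℕ) : ℝ) + 1)) ^ (p + 1) *
        Real.exp (56 * Real.sqrt ((p + 1 : ℕ) * ((p * (p + 1) : ℕ) : ℝ))))) *
        (1 + 2 * (Real.exp 83 * (p + 1))) ^ (p + 1 - i) := by
  set B := (2 : ℝ) ^ (p + 1) * ((3 * Real.exp 27 * (((p * (p + 1) : ℕ) : ℝ) + 1)) ^ (p + 1) *
        Real.exp (56 * Real.sqrt ((p + 1 : ℕ) * ((p * (p + 1) : ℕ) : ℝ)))) with hBdef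
  set θ := Real.exp 83 * (p + 1) with hθdef
  have hB : 0 ≤ B := by positivity
  have hθ : 0 ≤ θ := by positivity
  set y : ℕ → ℝ := fun j ↦ ‖(modularPolynomialCoeff p m).coeff j‖
  have hy0 : ∀ j, 0 ≤ y j := fun j ↦ norm_nonneg _
  have hyD : ∀ j, p + 1 < j → y j = 0 := fun j hj ↦ by
    show ‖(modularPolynomialCoeff p m).coeff j‖ = 0
    rw [coeff_modularPolynomialCoeff_eq_zero p hj, norm_zero]
  have hrec : ∀ i ≤ p + 1, y i ≤ B + ∑ j ∈ range (degBound p + 1),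
      if i < j then y j * θ ^ (j - i) else 0 := by
    intro i hi
    refine (norm_coeff_modularPolynomialCoeff_le_add_sum p m hi).trans (add_le_add ?_ ?_)
    · -- the bound for the formal product is monotone in the degree
      refine (norm_coeff_map_coeff_formalPhi_le p m _).trans ?_
      have hle : ((p * (p + 1 - i) : ℕ) : ℝ) ≤ ((p * (p + 1) : ℕ) : ℝ) := by
        exact_mod_cast Nat.mul_le_mul_left p (Nat.sub_le _ _)
      rw [hBdef]
      gcongr
    · refine sum_le_sum fun j _ ↦ ?_
      split_ifs with hij
      · by_cases hjp : j ≤ p + 1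
        · refine mul_le_mul_of_nonneg_left ((coeff_formalXJ_pow_le_geom j (j - i)).trans ?_) (hy0 j)
          refine pow_le_pow_left₀ (by positivity) ?_ _
          rw [hθdef]
          have : (j : ℝ) ≤ p + 1 := by exact_mod_cast hjp
          gcongr
        · show y j * _ ≤ y j * _
          rw [hyD j (not_le.mp hjp), zero_mul, zero_mul]
      · exact le_rfl
  rcases le_or_gt i (p + 1) with hi | hi
  · exact le_geom_of_rec hB hθ hyD hrec i hi
  · show y i ≤ _
    rw [hyD i hi]
    positivity

end level

/-- Bookkeeping of the constants: the level-`p` bound is `≤ exp(600 p √p)` for `p ≥ 2`. [folklore] -/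
theorem levelBound_le_exp {p : ℕ} (hp : 2 ≤ p) (i : ℕ) :
    (2 ^ (p + 1) * ((3 * Real.exp 27 * (((p * (p + 1) : ℕ) : ℝ) + 1)) ^ (p + 1) *
        Real.exp (56 * Real.sqrt ((p + 1 : ℕ) * ((p * (p + 1) : ℕ) : ℝ))))) *
        (1 + 2 * (Real.exp 83 * (p + 1))) ^ (p + 1 - i) ≤ Real.exp (600 * p * Real.sqrt p) := by
  -- `P = p + 1`, `t = √P`
  have hp2 : (2 : ℝ) ≤ p := by exact_mod_cast hp
  set P : ℝ := p + 1 with hPdef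
  have hP3 : 3 ≤ P := by rw [hPdef]; linarith
  have hP0 : 0 ≤ P := by linarith
  have hP1 : 1 ≤ P := by linarith
  set t : ℝ := Real.sqrt P with htdef
  have ht0 : 0 ≤ t := Real.sqrt_nonneg _
  have htt : t * t = P := Real.mul_self_sqrt hP0
  have ht1 : 1 ≤ t := by rw [htdef, ← Real.sqrt_one]; exact Real.sqrt_le_sqrt hP1
  have htexp : t ≤ Real.exp t := by have := Real.add_one_le_exp t; linarith
  have hPexp : P ≤ Real.exp (2 * t) := by
    rw [show (2 : ℝ) * t = t + t by ring, Real.exp_add, ← htt]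
    exact mul_le_mul htexp htexp ht0 (Real.exp_pos t).le
  have hcastP : ((p + 1 : ℕ) : ℝ) = P := by rw [hPdef]; push_cast; ring
  have hcastN : ((p * (p + 1) : ℕ) : ℝ) = p * P := by rw [hPdef]; push_cast; ring
  have hpP : (p : ℝ) ≤ P := by rw [hPdef]; linarith
  -- factor 1: `2^{p+1} ≤ e^P`
  have f1 : (2 : ℝ) ^ (p + 1) ≤ Real.exp P := by
    have h2e : (2 : ℝ) ≤ Real.exp 1 := by have := Real.add_one_le_exp (1 : ℝ); norm_num at this; linarith
    calc (2 : ℝ) ^ (p + 1) ≤ Real.exp 1 ^ (p + 1) := pow_le_pow_left₀ (by norm_num) h2e _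
      _ = Real.exp P := by rw [← Real.exp_nat_mul, mul_one, hPdef]; push_cast; ring_nf
  -- factor 2: `(3e^{27}(p(p+1)+1))^{p+1} ≤ e^{P(29 + 4t)}`
  have f2 : (3 * Real.exp 27 * (((p * (p + 1) : ℕ) : ℝ) + 1)) ^ (p + 1) ≤
      Real.exp (P * (29 + 4 * t)) := by
    have h3e : (3 : ℝ) ≤ Real.exp 2 := by have := Real.add_one_le_exp (2 : ℝ); norm_num at this; linarith
    have hN : ((p * (p + 1) : ℕ) : ℝ) + 1 ≤ P ^ 2 := by rw [hcastN, hPdef]; nlinarith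
    have hP2 : P ^ 2 ≤ Real.exp (4 * t) := by
      rw [show (4 : ℝ) * t = 2 * t + 2 * t by ring, Real.exp_add, sq]
      exact mul_le_mul hPexp hPexp hP0 (Real.exp_pos _).le
    have hbase : 3 * Real.exp 27 * (((p * (p + 1) : ℕ) : ℝ) + 1) ≤ Real.exp (29 + 4 * t) := by
      rw [show (29 : ℝ) + 4 * t = 2 + 27 + 4 * t by ring, Real.exp_add, Real.exp_add]
      refine mul_le_mul (mul_le_mul_of_nonneg_right h3e (Real.exp_pos _).le) (hN.trans hP2)
        (by positivity) (by positivity)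
    calc (3 * Real.exp 27 * (((p * (p + 1) : ℕ) : ℝ) + 1)) ^ (p + 1)
        ≤ Real.exp (29 + 4 * t) ^ (p + 1) := pow_le_pow_left₀ (by positivity) hbase _
      _ = Real.exp (P * (29 + 4 * t)) := by rw [← Real.exp_nat_mul, hPdef]; push_cast; ring_nf
  -- factor 3: `e^{56√((p+1)p(p+1))} ≤ e^{56 P t}`
  have f3 : Real.exp (56 * Real.sqrt ((p + 1 : ℕ) * ((p * (p + 1) : ℕ) : ℝ))) ≤
      Real.exp (56 * (P * t)) := by
    rw [Real.exp_le_exp, hcastP, hcastN]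
    have h1 : P * (p * P) ≤ (P * P) * P := by nlinarith
    have h2 : Real.sqrt (P * (p * P)) ≤ Real.sqrt ((P * P) * P) := Real.sqrt_le_sqrt h1
    rw [Real.sqrt_mul (mul_nonneg hP0 hP0), Real.sqrt_mul_self hP0] at h2
    linarith
  -- factor 4: `(1 + 2e^{83}(p+1))^{p+1-i} ≤ e^{P(84 + 2t)}`
  have f4 : (1 + 2 * (Real.exp 83 * (p + 1))) ^ (p + 1 - i) ≤ Real.exp (P * (84 + 2 * t)) := by
    have he1 : (2.7 : ℝ) ≤ Real.exp 1 := by have := Real.exp_one_gt_d9; linarith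
    have he83 : (1 : ℝ) ≤ Real.exp 83 := Real.one_le_exp (by norm_num)
    have he84 : Real.exp 84 = Real.exp 1 * Real.exp 83 := by rw [← Real.exp_add]; norm_num
    have hbase : 1 + 2 * (Real.exp 83 * (p + 1)) ≤ Real.exp 84 * P := by
      rw [he84, ← hPdef]
      have h1 : 2.7 * Real.exp 83 * P ≤ Real.exp 1 * Real.exp 83 * P := by gcongr
      have h2 : 3 ≤ Real.exp 83 * P := by nlinarith
      linarith
    have hbase1 : (1 : ℝ) ≤ 1 + 2 * (Real.exp 83 * (p + 1)) := by rw [← hPdef]; nlinarith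
    calc (1 + 2 * (Real.exp 83 * (p + 1))) ^ (p + 1 - i)
        ≤ (1 + 2 * (Real.exp 83 * (p + 1))) ^ (p + 1) := pow_le_pow_right₀ hbase1 (Nat.sub_le _ _)
      _ ≤ (Real.exp 84 * P) ^ (p + 1) := pow_le_pow_left₀ (by positivity) hbase _
      _ ≤ (Real.exp 84 * Real.exp (2 * t)) ^ (p + 1) := by gcongr
      _ = Real.exp (P * (84 + 2 * t)) := by
          rw [← Real.exp_add, ← Real.exp_nat_mul, hPdef]; push_cast; ring_nf
  -- assemble
  have hPt : P * t ≤ 3 * (p * Real.sqrt p) := by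
    have h1 : P ≤ 3 / 2 * p := by rw [hPdef]; linarith
    have h2 : t ≤ 2 * Real.sqrt p := by
      rw [htdef, show (2 : ℝ) * Real.sqrt p = Real.sqrt (4 * p) by
        rw [Real.sqrt_mul (by norm_num), show (4 : ℝ) = 2 ^ 2 by norm_num, Real.sqrt_sq (by norm_num)]]
      exact Real.sqrt_le_sqrt (by rw [hPdef]; linarith)
    calc P * t ≤ (3 / 2 * p) * (2 * Real.sqrt p) := mul_le_mul h1 h2 ht0 (by positivity)
      _ = 3 * (p * Real.sqrt p) := by ring
  have hPPt : P ≤ P * t := le_mul_of_one_le_right hP0 ht1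
  calc (2 ^ (p + 1) * ((3 * Real.exp 27 * (((p * (p + 1) : ℕ) : ℝ) + 1)) ^ (p + 1) *
        Real.exp (56 * Real.sqrt ((p + 1 : ℕ) * ((p * (p + 1) : ℕ) : ℝ))))) *
        (1 + 2 * (Real.exp 83 * (p + 1))) ^ (p + 1 - i)
      ≤ (Real.exp P * (Real.exp (P * (29 + 4 * t)) * Real.exp (56 * (P * t)))) *
          Real.exp (P * (84 + 2 * t)) := by
        refine mul_le_mul (mul_le_mul f1 (mul_le_mul f2 f3 (by positivity) (by positivity))
          (by positivity) (by positivity)) f4 (by positivity) (by positivity)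
    _ = Real.exp (114 * P + 62 * (P * t)) := by
        rw [← Real.exp_add, ← Real.exp_add, ← Real.exp_add]; ring_nf
    _ ≤ Real.exp (600 * p * Real.sqrt p) := by
        rw [Real.exp_le_exp]
        nlinarith

/-- **The height of the modular equation of prime level** (K. Mahler 1974, in the weak form
`log |coeff| ≪ p^{3/2}`; P. Cohen 1984 for the true order `6(p+1) log p`): there is an absolute
constant `c` (here `c = 600`) such that every coefficient of `Φ_p(X, Y) = modularPolynomial p`
has absolute value `≤ exp(c p √p)` for every prime `p`.  This is the hypothesis of
`Literature.NumberTheory.Transcendental.mahlerManinPadic_of_modularPolynomial_height`.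
[cite: NesterenkoPhilippon2001, Ch. 2, Lemma 2.5 and remark (Mahler: log L(Φ_n) ≪ n^{3/2})] -/
theorem exists_norm_coeff_modularPolynomial_le :
    ∃ c : ℝ, ∀ (p : ℕ) [Fact p.Prime], ∀ m i,
      ‖((modularPolynomial p).coeff m).coeff i‖ ≤ Real.exp (c * p * Real.sqrt p) :=
  ⟨600, fun p _ m i ↦ by
    rw [coeff_modularPolynomial]
    exact (norm_coeff_modularPolynomialCoeff_le p m i).trans
      (levelBound_le_exp (Fact.out : p.Prime).two_le i)⟩

end Literature.NumberTheory.EllipticCurves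

end
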